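import Literature.NumberTheory.LFunctions.Zhang2022.Section8MainTerms
import Literature.Analysis.Complex.RectangleResiduePolarParts
import HarnessLib

/-!
# Zhang (2022), Lemma 8.4 — III: the "direct calculation" on a rectangle (the model integrand and
# its residues)

Topic `Literature/NumberTheory/LFunctions/Zhang2022` (Landau–Siegel audit tree; verdict-neutral).
Y. Zhang, *Discrete mean estimates and the Landau–Siegel zero*, arXiv:2211.02515v1 (2022)
[Zhang2022LandauSiegel] — **an unrefereed manuscript under adjudication**; DAG node `Z22:Lem8.4.pf`
[Z22 p.47, tex L2412–2418]: "… the integral (8.9) is equal to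
`L′(1,χ)Π(d,r)·(2πi)⁻¹∮_{|s|=5α} (s+β_{j+1})(s+β_{j+2})s⁻¹ x^s ds/(s+β_μ)² + O(𝓛⁻⁶)`. The result now
follows by direct calculation."

The tree's `Section8MainTerms.circleIntegral_lemma84` kernel-checks the direct calculation on a CIRCLE.
The kernel proof of Lemma 8.4 (`Section8Lemma84.lean`) moves contours through RECTANGLES (the tree's
residue theorem `Literature.Analysis.Complex.rectBoundaryIntegral_eq_sum_of_poles`), in the variable
`u = s + β_μ` (so the double pole `(s+β_μ)⁻²` sits at `u = 0` and the simple pole `s⁻¹` at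
`u = β_μ`). This file PROVES the corresponding rectangle statement for the model integrand
`G₀(u) = M e^{uL}(u + β_a − β_μ)(u + β_b − β_μ)/((u − β_μ)u²)` (`M` standing for `L′(1,χ)Π(d,r)`,
`L = log x`, `β_a, β_b` for `β_{j+1}, β_{j+2}`):

* `rectBoundaryIntegral_modelG` (the integrand written out as a lambda) — for every rectangle containing `0` and `β_μ ≠ 0` in its interior,
  `∮_{∂R} G₀ = 2πi · M e^{β_μ L} 𝔤(β_a, β_b, β_μ; L)` with the tree's `frakg` (Lemma 8.4's `𝔤_{jμ}`):
  the residue at `u = β_μ` is `M e^{β_μ L}β_aβ_b/β_μ²`, the one at the double pole `u = 0` is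
  `M(1 − β_aβ_b/β_μ² − (β_a − β_μ)(β_b − β_μ)β_μ⁻¹L)` (`deriv_modelNum`);

Nothing about the manuscript's Theorems 1–2 or about Landau–Siegel zeros is asserted.

## References

* Y. Zhang, arXiv:2211.02515v1 (2022), §8 Lemma 8.4 (proof, last display).
  [cite: Zhang2022LandauSiegel, §8 Lemma 8.4]
* J. B. Conway, *Functions of One Complex Variable I*, GTM 11, Ch. V §2 Prop. 2.4. [cite: Conway1978, V.2.4]
-/

noncomputable section

open Complex Real Set MeasureTheory Filter Topology intervalIntegral

namespace Literature.NumberTheory.LFunctions.Zhang2022.Lemma84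

open Literature.Analysis.Complex

/-! ### The model integrand of Lemma 8.4 in the variable `u = s + β_μ`

The model integrand of Lemma 8.4 in the variable `u = s + β_μ` is
`G₀(u) = M e^{uL}(u + β_a − β_μ)(u + β_b − β_μ)/((u − β_μ)u²)` — the manuscript's
`L′(1,χ)Π(d,r)(s+β_{j+1})(s+β_{j+2})x^s/(s(s+β_μ)²)` after `u = s + β_μ`, up to the factor `x^{β_μ}`;
below it is written out as a lambda (no definitions in this file). -/

section Model

variable (M βa βb βμ L : ℂ)

/-- The entire part `E(u) = M e^{uL}(u + δ_a)(u + δ_b)` and its derivative. [folklore] -/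
private theorem hasDerivAt_modelEntire (u : ℂ) :
    HasDerivAt (fun u : ℂ => M * cexp (u * L) * ((u + (βa - βμ)) * (u + (βb - βμ))))
      (M * (L * cexp (u * L)) * ((u + (βa - βμ)) * (u + (βb - βμ))) +
        M * cexp (u * L) * ((u + (βb - βμ)) + (u + (βa - βμ)))) u := by
  have he : HasDerivAt (fun u : ℂ => cexp (u * L)) (cexp (u * L) * (1 * L)) u :=
    ((hasDerivAt_id u).mul_const L).cexp
  have hP : HasDerivAt (fun u : ℂ => (u + (βa - βμ)) * (u + (βb - βμ)))
      (1 * (u + (βb - βμ)) + (u + (βa - βμ)) * 1) u :=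
    ((hasDerivAt_id u).add_const _).mul ((hasDerivAt_id u).add_const _)
  refine ((he.const_mul M).mul hP).congr_deriv ?_
  ring

/-- The entire part is differentiable. [folklore] -/
private theorem differentiable_modelEntire :
    Differentiable ℂ (fun u : ℂ => M * cexp (u * L) * ((u + (βa - βμ)) * (u + (βb - βμ)))) :=
  fun u => (hasDerivAt_modelEntire M βa βb βμ L u).differentiableAt

/-- `N` is differentiable away from `β_μ`. [folklore] -/
private theorem differentiableAt_modelNum {u : ℂ} (hu : u ≠ βμ) :
    DifferentiableAt ℂ (fun u : ℂ => M * cexp (u * L) * ((u + (βa - βμ)) * (u + (βb - βμ))) / (u - βμ)) u := by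
  have h := ((differentiable_modelEntire M βa βb βμ L) u).div
    ((differentiableAt_id).sub (differentiableAt_const βμ)) (sub_ne_zero.2 hu)
  exact h

/-- `N₁` is differentiable away from `0`. [folklore] -/
private theorem differentiableAt_modelNum1 {u : ℂ} (hu : u ≠ 0) :
    DifferentiableAt ℂ (fun u : ℂ => M * cexp (u * L) * ((u + (βa - βμ)) * (u + (βb - βμ))) / u ^ 2) u := by
  have h := ((differentiable_modelEntire M βa βb βμ L) u).div
    (differentiableAt_id.pow 2) (pow_ne_zero 2 hu)
  exact h

/-- `G₀` is differentiable away from `0` and `β_μ`. [cite: Zhang2022LandauSiegel, §8 Lemma 8.4] -/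
theorem differentiableAt_modelG {u : ℂ} (hu0 : u ≠ 0) (hu : u ≠ βμ) :
    DifferentiableAt ℂ
      (fun u : ℂ => M * cexp (u * L) * ((u + (βa - βμ)) * (u + (βb - βμ))) / ((u - βμ) * u ^ 2)) u := by
  have h := ((differentiable_modelEntire M βa βb βμ L) u).div
    (((differentiableAt_id).sub (differentiableAt_const βμ)).mul (differentiableAt_id.pow 2))
    (mul_ne_zero (sub_ne_zero.2 hu) (pow_ne_zero 2 hu0))
  exact h

/-- `G₀ = N/u²` off `0`. [folklore] -/
private theorem modelG_eq_modelNum_div {u : ℂ} (hu0 : u ≠ 0) (hu : u ≠ βμ) :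
    (fun u : ℂ => M * cexp (u * L) * ((u + (βa - βμ)) * (u + (βb - βμ))) / ((u - βμ) * u ^ 2)) u =
      (fun u : ℂ => M * cexp (u * L) * ((u + (βa - βμ)) * (u + (βb - βμ))) / (u - βμ)) u / (u - 0) ^ (1 + 1) := by
  have h1 : u - βμ ≠ 0 := sub_ne_zero.2 hu
  simp only [sub_zero]
  field_simp
  ring

/-- `G₀ = N₁/(u − β_μ)` off `β_μ`. [folklore] -/
private theorem modelG_eq_modelNum1_div {u : ℂ} (hu0 : u ≠ 0) (hu : u ≠ βμ) :
    (fun u : ℂ => M * cexp (u * L) * ((u + (βa - βμ)) * (u + (βb - βμ))) / ((u - βμ) * u ^ 2)) u =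
      (fun u : ℂ => M * cexp (u * L) * ((u + (βa - βμ)) * (u + (βb - βμ))) / u ^ 2) u / (u - βμ) ^ (0 + 1) := by
  have h1 : u - βμ ≠ 0 := sub_ne_zero.2 hu
  have h2 : u ^ 2 ≠ 0 := pow_ne_zero 2 hu0
  simp only [zero_add, pow_one]
  field_simp

/-- **The residue at the double pole `u = 0`**: `N′(0) = M(−(δ_a+δ_b)/β_μ − δ_aδ_b/β_μ² − δ_aδ_bβ_μ⁻¹L)`,
`δ = β − β_μ`. [cite: Zhang2022LandauSiegel, §8 Lemma 8.4] -/
theorem deriv_modelNum (hμ0 : βμ ≠ 0) :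
    deriv (fun u : ℂ => M * cexp (u * L) * ((u + (βa - βμ)) * (u + (βb - βμ))) / (u - βμ)) 0 =
      M * (-(((βa - βμ) + (βb - βμ)) / βμ) - (βa - βμ) * (βb - βμ) / βμ ^ 2 -
        (βa - βμ) * (βb - βμ) / βμ * L) := by
  have hE := hasDerivAt_modelEntire M βa βb βμ L 0
  have hD : HasDerivAt (fun u : ℂ => u - βμ) 1 0 := (hasDerivAt_id (0 : ℂ)).sub_const βμ
  have hne : (0 : ℂ) - βμ ≠ 0 := by rwa [zero_sub, neg_ne_zero]
  have h := hE.div hD hne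
  have heq : (fun u : ℂ => M * cexp (u * L) * ((u + (βa - βμ)) * (u + (βb - βμ)))) /
      (fun u : ℂ => u - βμ) = (fun u : ℂ => M * cexp (u * L) * ((u + (βa - βμ)) * (u + (βb - βμ))) / (u - βμ)) := by
    funext u; rfl
  rw [heq] at h
  rw [h.deriv]
  simp only [zero_mul, Complex.exp_zero, zero_add, mul_one, zero_sub]
  field_simp
  ring

/-- **The "direct calculation" of Lemma 8.4 on a rectangle**: for `a < b`, `c < d` with `0` and
`β_μ ≠ 0` inside the open rectangle `(a,b)×(c,d)` and any `M, β_a, β_b, L ∈ ℂ`,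
`∮_{∂R} G₀ = 2πi·M·e^{β_μL}·𝔤(β_a,β_b,β_μ;L)` where `𝔤 = frakg` is the main term of Lemma 8.4
(`β_aβ_b/β_μ² + (1 − β_aβ_b/β_μ² − (β_a−β_μ)(β_b−β_μ)β_μ⁻¹L)e^{−β_μL}`): the residue theorem with
the simple pole at `β_μ` (residue `M e^{β_μL}β_aβ_b/β_μ²`) and the double pole at `0` (residue
`N′(0)`, `deriv_modelNum`). [cite: Zhang2022LandauSiegel, §8 Lemma 8.4 (proof, last display)]
[cite: Conway1978, V.2.4] -/
theorem rectBoundaryIntegral_modelG {a b c d : ℝ} (hab : a < b) (hcd : c < d)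
    (h0 : (0 : ℂ) ∈ Ioo a b ×ℂ Ioo c d) (hμ : βμ ∈ Ioo a b ×ℂ Ioo c d) (hμ0 : βμ ≠ 0) :
    rectBoundaryIntegral
        (fun u : ℂ => M * cexp (u * L) * ((u + (βa - βμ)) * (u + (βb - βμ))) / ((u - βμ) * u ^ 2)) a b c d =
      2 * π * I * (M * cexp (βμ * L) * frakg βa βb βμ L) := by
  classical
  set G : ℂ → ℂ := (fun u : ℂ => M * cexp (u * L) * ((u + (βa - βμ)) * (u + (βb - βμ))) / ((u - βμ) * u ^ 2)) with hGdef
  set N0 : ℂ → ℂ := (fun u : ℂ => M * cexp (u * L) * ((u + (βa - βμ)) * (u + (βb - βμ))) / (u - βμ)) with hN0def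
  set N1 : ℂ → ℂ := (fun u : ℂ => M * cexp (u * L) * ((u + (βa - βμ)) * (u + (βb - βμ))) / u ^ 2) with hN1def
  -- pole data
  set S : Finset ℂ := {0, βμ} with hS
  set n : ℂ → ℕ := fun p => if p = 0 then 1 else 0 with hn
  set φ : ℂ → ℂ → ℂ := fun p => if p = 0 then N0 else N1 with hφ
  have hS' : (S : Set ℂ) ⊆ Ioo a b ×ℂ Ioo c d := by
    intro p hp
    simp only [hS, Finset.coe_insert, Finset.coe_singleton, Set.mem_insert_iff,
      Set.mem_singleton_iff] at hp
    rcases hp with rfl | rfl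
    · exact h0
    · exact hμ
  have hF : DifferentiableOn ℂ G (Set.univ \ ↑S) := by
    intro u hu
    have hu' : u ∉ (S : Set ℂ) := hu.2
    simp only [hS, Finset.coe_insert, Finset.coe_singleton, Set.mem_insert_iff,
      Set.mem_singleton_iff, not_or] at hu'
    exact (differentiableAt_modelG M βa βb βμ L hu'.1 hu'.2).differentiableWithinAt
  have hpole : ∀ p ∈ S, ∃ V ∈ 𝓝 p, DifferentiableOn ℂ (φ p) V ∧
      ∀ z ∈ V, z ≠ p → G z = φ p z / (z - p) ^ (n p + 1) := by
    intro p hp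
    simp only [hS, Finset.mem_insert, Finset.mem_singleton] at hp
    rcases hp with hp | hp
    · rw [hp]
      refine ⟨{u | u ≠ βμ}, (isOpen_ne).mem_nhds (Ne.symm hμ0), ?_, ?_⟩
      · intro u hu
        simp only [hφ, if_true]
        exact (differentiableAt_modelNum M βa βb βμ L hu).differentiableWithinAt
      · intro z hz hz0
        simp only [hφ, hn, if_true]
        exact modelG_eq_modelNum_div M βa βb βμ L hz0 hz
    · rw [hp]
      refine ⟨{u | u ≠ 0}, (isOpen_ne).mem_nhds hμ0, ?_, ?_⟩
      · intro u hu
        simp only [hφ, if_neg hμ0]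
        exact (differentiableAt_modelNum1 M βa βb βμ L hu).differentiableWithinAt
      · intro z hz hzμ
        simp only [hφ, hn, if_neg hμ0]
        exact modelG_eq_modelNum1_div M βa βb βμ L hz hzμ
  have hres := rectBoundaryIntegral_eq_sum_of_poles hab hcd S G n φ Set.univ
    isOpen_univ (Set.subset_univ _) hS' hF hpole
  rw [hres]
  congr 1
  -- the two residues
  have h0μ : (0 : ℂ) ≠ βμ := Ne.symm hμ0
  rw [hS, Finset.sum_insert (by simp [h0μ]), Finset.sum_singleton]
  simp only [hn, hφ, if_true, if_neg hμ0, Function.iterate_one, Function.iterate_zero, id_eq,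
    Function.swap, dslope_same]
  rw [deriv_modelNum M βa βb βμ L hμ0]
  simp only [hN1def, frakg]
  have hexp : cexp (-(βμ * L)) = (cexp (βμ * L))⁻¹ := by rw [Complex.exp_neg]
  rw [hexp]
  have hne : cexp (βμ * L) ≠ 0 := Complex.exp_ne_zero _
  field_simp
  ring

end Model

end Literature.NumberTheory.LFunctions.Zhang2022.Lemma84
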